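import Summits.BirchSwinnertonDyer.BirchSwinnertonDyer.Theorems.TwoAdicConverseMultLambdaWallSplit
import Summits.BirchSwinnertonDyer.BirchSwinnertonDyer.Theorems.TwoAdicConverseMultLambdaWallIsogeny
import HarnessLib

/-!
# Route `TwoAdicConverse` (rung S3), multiplicative branch, SPLIT sign: LINE `cycint` v4 ⟹ v5 in the kernel — the
# isogeny-hedged INTEGRAL split wall implies the `λ`-form split wall, modulo K11 at the isogenous member (items 19219 / 19187; helper)

Cell `bsd-2adic` (run/shared/lean/pub/bsd-2adic/), seat `bsd-2adic-conv-2` (GEN 13). THEOREMS ONLY — nothing asserted, no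
definition, no named fact, nothing booked; BSD is not proved by any of this. PARTITION (D-0054): none — RANK axis (S3 mult, split sign).

WHAT THIS FILE SETTLES (T1 bookkeeping of the split re-shape, `Theorems/TwoAdicConverseMultLambdaWallSplit.lean`, this GEN; the
split twin of GEN 12's `Theorems/TwoAdicConverseMultLambdaWallIsogeny.lean`, p493939). LINE `cycint` v3/v4 ask, on the finite-`Sel`
SPLIT locus, the INTEGRAL Eisenstein direction `X5.O1.MultEisensteinDivisibilityAtTwo W'` (`ϖ·L₂ ∣ T·f_X`) at SOME `ℚ`-isogenous
globally minimal `W'` (`stub_eisSplitFinSel`); the v5 candidate asks the split `λ`-part AT `W` (λ-WALL-sp: `ι(T·g·h) = 2ⁿ·L₂ ⇒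
g·h ≠ 0 ∧ λ(g·h) ≤ λ(g)`). Here:

* §1 `lam_mul_le_of_C_mul_X_mul_eq` — pure `Λ`-algebra: two opposite divisibilities with a trivial-zero factor `T` and any nonzero
  constant pin `λ` (the `T`-version of p491683's `lam_mul_le_of_C_mul_eq`);
* §2 `multLambdaPartSplit_of_multEisenstein` — the MEMBER-WISE integral split clause at `W` implies the split `λ`-part at `W`
  (modularity supplies the rational period ratio `ϖ = a/d`; `C(2ⁿ·d)·(T·g) = (k·C a)·(T·(g·h))` in `Λ`);
* §3 `multLambdaPartSplit_of_isIsogenous_of_multEisenstein_of_katoRat` — for `W ∼ W'`, `W` split multiplicative at `2`, the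
  integral wall at `W'` and K11 at `W'`: the split `λ`-part at `W` (Kato's factorisation at `W'`, §2 at `W'`, «two factorisations of
  the same `L₂` have the same `λ`» `lam_eq_of_iota_eq_of_iota_eq`, and Greenberg–Vatsal's isogeny invariance of `λ` — tree theorem
  `X2.IsogenyLambdaInvariant.lambda_eq_of_isogeny` with `X1.ParitySqueeze.lam_generator_eq_lambdaInvariant`); hence
  `lamWallSplit_of_wallS3Split_of_katoRat` — **v4's split stub ⟹ v5's split stub** modulo {modularity, Greenberg Thm. 1.5, K11 at
  split-at-`2` curves}: the re-shape is a WEAKENING in the kernel modulo the K11 binder; and v4's split road / v4's whole stub set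
  recovered THROUGH the `λ`-form roads (`splitMultRankZeroTwoConverse_of_wallS3_of_katoRat'`,
  `multiplicativeRankZeroTwoConverse_of_lamWallNonsplit_of_wallS3Split_of_katoRat`).

HONEST FRAMING: bookkeeping between two research objects, neither in print at `p = 2`; nothing is booked.

References: Greenberg–Vatsal, Invent. Math. 142 (2000) §2 p. 28 and p. 4 [GreenbergVatsal2000]; Kato, Astérisque 295 (2004) Thm. 17.4, §17.13
[Kato2004Asterisque]; Greenberg, LNM 1716 (1999) Thm. 1.5, §4 pp. 112–113 [GreenbergLNM1716]; Spieß, Invent. Math. 196 (2014) Thm. 5.7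
[Spiess2014Invent]; Washington, GTM 83, §7.1, §13.2 [Washington1997].
-/


set_option linter.dupNamespace false
set_option autoImplicit false

noncomputable section

open scoped Classical MatrixGroups ModularForm

open CongruenceSubgroup WeierstrassCurve Literature.NumberTheory.EllipticCurves
  Literature.NumberTheory.EllipticCurves.ModularForms
  Literature.NumberTheory.EllipticCurves.Greenberg1999
  Literature.NumberTheory.EllipticCurves.Spiess2014
  Literature.NumberTheory.EllipticCurves.Rank1Residual
  Literature.NumberTheory.EllipticCurves.Rank1Residual.Typed
  Summit.BirchSwinnertonDyer.Rank1Residual.X1.MuLambda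
  Summit.BirchSwinnertonDyer.Rank1Residual.X1.ParitySqueeze
  Summit.BirchSwinnertonDyer.Rank1Residual.X2.IsogenyLambdaInvariant
  Summit.BirchSwinnertonDyer.Rank1Residual.X5
  Summit.BirchSwinnertonDyer.Rank1Residual.X5.O1
  Summit.BirchSwinnertonDyer.BirchSwinnertonDyer.Theses.TwoAdicConverse

namespace Summit.BirchSwinnertonDyer.BirchSwinnertonDyer.Theorems

namespace MultLambdaWall

/-! ## §1 Pure `Λ`-algebra: two opposite divisibilities with a trivial-zero factor `T` and a nonzero constant -/

section Algebra

variable {p : ℕ} [Fact p.Prime]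

/-- **Two opposite divisibilities with a trivial-zero factor pin `λ`.** If `C c · (T·g) = k · (T·(g·h))` in `Λ` with
`c ∈ ℤ_p` nonzero and `g ≠ 0`, then `g·h ≠ 0` and `λ(g·h) ≤ λ(g)`: `lam_mul_le_of_C_mul_eq` at `T·g` (the factor `T` is
nonzero and `λ` is additive, so `λ(T)` cancels). The split-multiplicative shape of p491683 §1.
[cite: GreenbergVatsal2000, p. 4 (after Thm. (1.2))] -/
theorem lam_mul_le_of_C_mul_X_mul_eq {c : ℤ_[p]} (hc : c ≠ 0) {g h k : IwasawaAlgebra p} (hg : g ≠ 0)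
    (heq : PowerSeries.C c * (PowerSeries.X * g) = k * (PowerSeries.X * (g * h))) :
    g * h ≠ 0 ∧ lam (g * h) ≤ lam g := by
  have hXg : PowerSeries.X * g ≠ 0 := mul_ne_zero PowerSeries.X_ne_zero hg
  have heq' : PowerSeries.C c * (PowerSeries.X * g) = k * ((PowerSeries.X * g) * h) := by
    rw [heq, mul_assoc]
  obtain ⟨hXgh, hle⟩ := lam_mul_le_of_C_mul_eq hc hXg heq'
  have hh : h ≠ 0 := fun h0 => hXgh (by rw [h0, mul_zero])
  refine ⟨mul_ne_zero hg hh, ?_⟩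
  rw [lam_mul hXg hh, lam_mul PowerSeries.X_ne_zero hg] at hle
  rw [lam_mul hg hh]
  omega

end Algebra

/-! ## §2 The member-wise integral split clause at `W` implies the split `λ`-part at `W` -/

section Strength

variable (W : WeierstrassCurve ℚ) [W.IsElliptic] [W.IsGloballyMinimal]

/-- **T-mult-4-int at `W` (split clause) ⟹ the split `λ`-part at `W`.** Modularity `hmod` supplies, for the (unique) newform
`f` of `W`, a rational `ϖ > 0` with `ϖ·Ω_W = Ω⁺_f`; `MultEisensteinDivisibilityAtTwo W` (split clause) reads `ι(T·g) = ι k · ϖ·L`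
for the generator `g` of `char_Λ X`; with `ι(T·g·h) = 2ⁿ·L` this gives `C(2ⁿ·d)·(T·g) = (k·C a)·(T·(g·h))` in `Λ` (`ϖ = a/d`),
whence `g·h ≠ 0` and `λ(g·h) ≤ λ(g)` (§1). So λ-WALL-sp is implied by the K4ᵐ member-wise object on the finite-`Sel` split locus;
nothing asserted. The split twin of p491683's `multLambdaPartNonsplit_of_multEisenstein`.
[cite: GreenbergVatsal2000, p. 4 (after Thm. (1.2))] [cite: GreenbergLNM1716, §4 pp. 112–113] -/
theorem multLambdaPartSplit_of_multEisenstein (hmod : nonempty_modularParametrizationData)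
    (hmult : Mult W 2) (hsp : W.HasSplitMultiplicativeReductionAtPrime 2)
    (hE : MultEisensteinDivisibilityAtTwo W) :
    ∀ (κ : ZpExtension ℚ 2) (γ : Field.absoluteGaloisGroup ℚ), κ.IsCyclotomic →
      κ.IsTopGenerator γ → IsCyclotomicVariable 2 γ →
      ∀ ⦃N : ℕ⦄ [NeZero N] (f : CuspForm (Gamma0 N) 2), IsNewformOf W f →
      ∀ (D : W.SelmerDualData κ γ) (g h : IwasawaAlgebra 2) (n : ℕ), D.charIdeal = Ideal.span {g} →
      ∀ L : PowerSeries ℚ_[2], IsSplitMultPAdicLFunctionOf f 2 L →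
        iwasawaToPowerSeries 2 (PowerSeries.X * (g * h)) = PowerSeries.C ((2 : ℚ_[2]) ^ n) * L →
        g * h ≠ 0 ∧ lam (g * h) ≤ lam g := by
  intro κ γ hκ hγ hγ' N _ f hf D g h n hchar L hL hι
  haveI : NeZero (W.conductorNorm ℤ) := ⟨(W.conductorNorm_pos_holds).ne'⟩
  obtain ⟨Dm⟩ := hmod W
  have hfm : IsNewformOf W Dm.f := Dm.isNewformOf
  obtain ⟨ϖ, hϖpos, hϖ, -⟩ := Dm.exists_rat_mul_realPeriodRat_eq_plusPeriod
  -- the given newform `f` IS the datum's newform: same level, then uniqueness of the newform of `W`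
  obtain rfl : N = W.conductorNorm ℤ := hf.level_eq_level hfm
  have hff : f = Dm.f := hf.unique hfm
  have hϖf : (ϖ : ℝ) * W.realPeriodRat = plusPeriod f := by rw [hff]; exact hϖ
  -- T-mult-4-int, split clause at `(f, ϖ, D, g)`: `ι(T·g) = ι k · (ϖ · L)`
  obtain ⟨-, hsp'⟩ := hE κ γ hκ hγ hγ' hmult f hf ϖ hϖf D g hchar
  obtain ⟨k, hk⟩ := hsp' hsp L hL
  have hg : g ≠ 0 := generator_ne_zero_of_charIdeal_eq W D hchar
  -- clear the denominator of `ϖ = a/d`: `C(2ⁿ·d)·ι(T·g) = ι(k·C a)·ι(T·(g·h))`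
  have hϖ0 : ϖ ≠ 0 := hϖpos.ne'
  have hnum : ϖ.num ≠ 0 := Rat.num_ne_zero.mpr hϖ0
  have hϖeq : ((ϖ.den : ℚ) : ℚ_[2]) * (ϖ : ℚ_[2]) = ((ϖ.num : ℚ) : ℚ_[2]) := by
    rw [← Rat.cast_mul, Rat.den_mul_eq_num]
  have key : iwasawaToPowerSeries 2 (PowerSeries.C (((2 : ℤ_[2]) ^ n) * (ϖ.den : ℤ_[2])) * (PowerSeries.X * g)) =
      iwasawaToPowerSeries 2 ((k * PowerSeries.C ((ϖ.num : ℤ) : ℤ_[2])) * (PowerSeries.X * (g * h))) := by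
    have e1 : iwasawaToPowerSeries 2 (PowerSeries.C (((2 : ℤ_[2]) ^ n) * (ϖ.den : ℤ_[2])) * (PowerSeries.X * g)) =
        PowerSeries.C (((2 : ℚ_[2]) ^ n) * ((ϖ.den : ℚ) : ℚ_[2])) * iwasawaToPowerSeries 2 (PowerSeries.X * g) := by
      rw [map_mul, PowerSeries.map_C]
      congr 2
    have e2 : iwasawaToPowerSeries 2 ((k * PowerSeries.C ((ϖ.num : ℤ) : ℤ_[2])) * (PowerSeries.X * (g * h))) =
        iwasawaToPowerSeries 2 k * PowerSeries.C (((ϖ.num : ℚ) : ℚ_[2])) *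
          iwasawaToPowerSeries 2 (PowerSeries.X * (g * h)) := by
      rw [map_mul, map_mul, PowerSeries.map_C]
      congr 2
    rw [e1, e2, hι, hk, ← hϖeq, map_mul PowerSeries.C, map_mul PowerSeries.C]
    ring
  have heq : PowerSeries.C (((2 : ℤ_[2]) ^ n) * (ϖ.den : ℤ_[2])) * (PowerSeries.X * g) =
      (k * PowerSeries.C ((ϖ.num : ℤ) : ℤ_[2])) * (PowerSeries.X * (g * h)) := iwasawaToPowerSeries_injective 2 key
  have hc : ((2 : ℤ_[2]) ^ n) * (ϖ.den : ℤ_[2]) ≠ 0 := by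
    refine mul_ne_zero (pow_ne_zero n two_ne_zero) ?_
    exact_mod_cast ϖ.den_nz
  exact lam_mul_le_of_C_mul_X_mul_eq hc hg heq

end Strength

/-! ## §3 The split `λ`-part at `W` from the integral wall at an isogenous `W'`; v4's split stub ⟹ λ-WALL-sp -/

section Transport

variable {W W' : WeierstrassCurve ℚ} [W.IsElliptic] [W'.IsElliptic] [W.IsGloballyMinimal] [W'.IsGloballyMinimal]

/-- **Isogeny-hedged integral wall ⟹ split `λ`-part, per curve, modulo K11 at the isogenous member.** `W ∼ W'` `ℚ`-isogenous
globally minimal elliptic curves, `W` SPLIT multiplicative at `2` (hence so is `W'`), `W'` multiplicative at `2` with the integral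
Eisenstein direction `MultEisensteinDivisibilityAtTwo W'`; PRINT {modularity `hmod`, Greenberg Thm. 1.5 `h15`} and K11 at `W'`
(`hK'`). Then the split `λ`-part holds AT `W`: for `W`'s data `(κ, γ, f, D, g, h, n, L)` with `char X(W) = (g)` and
`ι(T·g·h) = 2ⁿ·L₂(f)`, `g·h ≠ 0 ∧ λ(g·h) ≤ λ(g)`. Proof: `f` is a newform of `W'` (Faltings, `IsNewformOf.of_isIsogenous`); K11 at
`W'` gives `g'' ∈ char X(W') = (g')` with `ι(T·g'') = 2^{n'}·L`, `g'' = a·g'`; the member-wise transport at `W'`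
(`multLambdaPartSplit_of_multEisenstein`) gives `g'·a ≠ 0 ∧ λ(g'·a) ≤ λ(g')`; two factorisations of the same `L` have the same
`λ` (`lam_eq_of_iota_eq_of_iota_eq`, p493939 §1, at `T·(g·h)` and `T·(g'·a)`); and `λ(g) = λ(X(W)) = λ(X(W')) = λ(g')`
(`lam_generator_eq_lambdaInvariant`, torsion by Thm. 1.5; Greenberg–Vatsal `lambda_eq_of_isogeny`). The split twin of p493939's
`multLambdaPartNonsplit_of_isIsogenous_of_multEisenstein_of_descent`. [cite: GreenbergVatsal2000, §2 p. 28 and p. 4]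
[cite: Kato2004Asterisque, Thm. 17.4 (1)(2) (p. 273; shape) and §17.13] [cite: GreenbergLNM1716, Thm. 1.5 (p. 61)] -/
theorem multLambdaPartSplit_of_isIsogenous_of_multEisenstein_of_katoRat
    (hmod : nonempty_modularParametrizationData) (h15 : thm15_isTorsion_multiplicative_rat)
    (hiso : IsIsogenous W W') (hmult : Mult W 2) (hsp : W.HasSplitMultiplicativeReductionAtPrime 2)
    (hmult' : Mult W' 2) (hK' : KatoMultiplicativeDivisibilityRat W' 2) (hE' : MultEisensteinDivisibilityAtTwo W') :
    ∀ (κ : ZpExtension ℚ 2) (γ : Field.absoluteGaloisGroup ℚ), κ.IsCyclotomic →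
      κ.IsTopGenerator γ → IsCyclotomicVariable 2 γ →
      ∀ ⦃N : ℕ⦄ [NeZero N] (f : CuspForm (Gamma0 N) 2), IsNewformOf W f →
      ∀ (D : W.SelmerDualData κ γ) (g h : IwasawaAlgebra 2) (n : ℕ), D.charIdeal = Ideal.span {g} →
      ∀ L : PowerSeries ℚ_[2], IsSplitMultPAdicLFunctionOf f 2 L →
        iwasawaToPowerSeries 2 (PowerSeries.X * (g * h)) = PowerSeries.C ((2 : ℚ_[2]) ^ n) * L →
        g * h ≠ 0 ∧ lam (g * h) ≤ lam g := by
  intro κ γ hκ hγ hγ' N _ f hf D g h n hchar L hL hι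
  haveI : Fact (Nat.Prime 2) := ⟨Nat.prime_two⟩
  have hiso' : IsIsogenous W' W := hiso.symm_of_charZero
  have hsp' : W'.HasSplitMultiplicativeReductionAtPrime 2 :=
    (hasSplitMultiplicativeReductionAtPrime_two_iff_of_isIsogenous hiso).mp hsp
  have hf' : IsNewformOf W' f := hf.of_isIsogenous hiso'
  -- the split `λ`-part at `W'` (member-wise transport of the integral wall)
  have hlam' := multLambdaPartSplit_of_multEisenstein W' hmod hmult' hsp' hE'
  -- a dual datum and a generator at `W'`
  obtain ⟨D'⟩ := W'.nonempty_selmerDualData_holds κ γ hγ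
  haveI : Module.Finite (IwasawaAlgebra 2) D'.X := D'.module_finite_holds hγ
  haveI : Module.Finite (IwasawaAlgebra 2) D.X := D.module_finite_holds hγ
  haveI : (Module.charIdeal (IwasawaAlgebra 2) D'.X).IsPrincipal := charIdeal_isPrincipal_holds 2 D'.X
  obtain ⟨g', hg'⟩ := Submodule.IsPrincipal.principal (Module.charIdeal (IwasawaAlgebra 2) D'.X)
  have hchar' : D'.charIdeal = Ideal.span {g'} := hg'
  have hg0 : g ≠ 0 := generator_ne_zero_of_charIdeal_eq W D hchar
  have hg'0 : g' ≠ 0 := generator_ne_zero_of_charIdeal_eq W' D' hchar'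
  -- K11 at `W'`, split clause: `ι(T·g'') = 2^{n'}·L`, `g'' ∈ (g')`
  obtain ⟨-, -, hspK⟩ := hK' κ γ hκ hγ hγ' hmult' f hf' D'
  obtain ⟨n', g'', hg''mem, hι'⟩ := hspK hsp' L hL
  rw [hchar'] at hg''mem
  obtain ⟨a, ha⟩ := Ideal.mem_span_singleton'.mp hg''mem
  have h22 : ((2 : ℕ) : ℚ_[2]) = (2 : ℚ_[2]) := by norm_num
  have hι'' : iwasawaToPowerSeries 2 (PowerSeries.X * (g' * a)) = PowerSeries.C ((2 : ℚ_[2]) ^ n') * L := by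
    rw [mul_comm g' a, ha, hι', h22]
  -- the split `λ`-part at `W'` applied to `(f, D', g', a, n')`
  obtain ⟨hg'a0, hle'⟩ := hlam' κ γ hκ hγ hγ' f hf' D' g' a n' hchar' L hL hι''
  -- the two factorisations of `L` have the same `λ`
  have hιn : iwasawaToPowerSeries 2 (PowerSeries.X * (g * h)) = PowerSeries.C (((2 : ℕ) : ℚ_[2]) ^ n) * L := by
    rw [h22]; exact hι
  have hιn' : iwasawaToPowerSeries 2 (PowerSeries.X * (g' * a)) = PowerSeries.C (((2 : ℕ) : ℚ_[2]) ^ n') * L := by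
    rw [h22]; exact hι''
  have hXg'a : PowerSeries.X * (g' * a) ≠ 0 := mul_ne_zero PowerSeries.X_ne_zero hg'a0
  obtain ⟨hXgh0, hlameq⟩ := lam_eq_of_iota_eq_of_iota_eq hιn hιn' hXg'a
  have hgh0 : g * h ≠ 0 := fun h0 => hXgh0 (by rw [h0, mul_zero])
  have hlameq' : lam (g * h) = lam (g' * a) := by
    rw [lam_mul PowerSeries.X_ne_zero hgh0, lam_mul PowerSeries.X_ne_zero hg'a0] at hlameq
    omega
  -- `λ(g) = λ(X(W)) = λ(X(W')) = λ(g')`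
  have hX : D.IsTorsion := h15 W 2 hmult f hf κ γ hκ hγ D
  have hX' : D'.IsTorsion := h15 W' 2 hmult' f hf' κ γ hκ hγ D'
  have hlamg : lam g = D.lambda := lam_generator_eq_lambdaInvariant D.X hX hg0 hchar
  have hlamg' : lam g' = D'.lambda := lam_generator_eq_lambdaInvariant D'.X hX' hg'0 hchar'
  obtain ⟨φ⟩ := hiso
  have hDD' : D.lambda = D'.lambda := lambda_eq_of_isogeny φ D D'
  refine ⟨hgh0, ?_⟩
  rw [hlameq', hlamg, hDD', ← hlamg']
  exact hle'

end Transport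

/-- **LINE `cycint`: v3/v4 `stub_eisSplitFinSel` ⟹ λ-WALL-sp, modulo {modularity, Greenberg Thm. 1.5, K11 at split-at-`2` curves}.**
So re-shaping the split research wall to `λ`-form is a WEAKENING in the kernel modulo the K11 binder (the converse direction fails:
λ-WALL-sp carries no `μ`, no period, no integral unit). [cite: GreenbergVatsal2000, §2 p. 28 and p. 4]
[cite: Kato2004Asterisque, Thm. 17.4 (1)(2) (p. 273; shape) and §17.13] [cite: GreenbergLNM1716, Thm. 1.5 (p. 61)] -/
theorem lamWallSplit_of_wallS3Split_of_katoRat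
    (hmod : nonempty_modularParametrizationData) (h15 : thm15_isTorsion_multiplicative_rat)
    (hKsp : ∀ (W : WeierstrassCurve ℚ) [W.IsElliptic] [W.IsGloballyMinimal],
      W.HasSplitMultiplicativeReductionAtPrime 2 → KatoMultiplicativeDivisibilityRat W 2)
    (hWsp : ∀ (W : WeierstrassCurve ℚ) [W.IsElliptic] [W.IsGloballyMinimal], ¬ W.HasCM → Mult W 2 →
      W.HasSplitMultiplicativeReductionAtPrime 2 → W.selmerCorank 2 = 0 →
        ∃ (W' : WeierstrassCurve ℚ) (_ : W'.IsElliptic) (_ : W'.IsGloballyMinimal),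
          IsIsogenous W W' ∧ Mult W' 2 ∧ MultEisensteinDivisibilityAtTwo W') :
    ∀ (W : WeierstrassCurve ℚ) [W.IsElliptic] [W.IsGloballyMinimal], ¬ W.HasCM → Mult W 2 →
      W.HasSplitMultiplicativeReductionAtPrime 2 → W.selmerCorank 2 = 0 →
      ∀ (κ : ZpExtension ℚ 2) (γ : Field.absoluteGaloisGroup ℚ), κ.IsCyclotomic →
      κ.IsTopGenerator γ → IsCyclotomicVariable 2 γ →
      ∀ ⦃N : ℕ⦄ [NeZero N] (f : CuspForm (Gamma0 N) 2), IsNewformOf W f →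
      ∀ (D : W.SelmerDualData κ γ) (g h : IwasawaAlgebra 2) (n : ℕ), D.charIdeal = Ideal.span {g} →
      ∀ L : PowerSeries ℚ_[2], IsSplitMultPAdicLFunctionOf f 2 L →
        iwasawaToPowerSeries 2 (PowerSeries.X * (g * h)) = PowerSeries.C ((2 : ℚ_[2]) ^ n) * L →
        g * h ≠ 0 ∧ lam (g * h) ≤ lam g := by
  intro W _ _ hcm hmult hsp hsel
  obtain ⟨W', _, _, hiso, hmult', hE'⟩ := hWsp W hcm hmult hsp hsel
  have hsp' : W'.HasSplitMultiplicativeReductionAtPrime 2 :=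
    (hasSplitMultiplicativeReductionAtPrime_two_iff_of_isIsogenous hiso).mp hsp
  exact multLambdaPartSplit_of_isIsogenous_of_multEisenstein_of_katoRat hmod h15 hiso hmult hsp hmult' (hKsp W' hsp') hE'

/-- **Consistency: v4's split road THROUGH λ-WALL-sp.** PRINT {A236, modularity, Thm. 1.5, Spieß Thm. 5.7} + K11 at split-at-`2`
curves + v4's `stub_eisSplitFinSel` ⟹ the split half of 19219, via `lamWallSplit_of_wallS3Split_of_katoRat` and the split half `splitMultRankZeroTwoConverse_of_lamWallSplit_of_katoRat` (same conclusion
as `MultSplitWeakEZ.splitMultRankZeroTwoConverse_of_wallS3_of_weakEZ`, p462242, which needs no Kato input — here K11 is the price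
of the `λ`-detour). [cite: Spiess2014Invent, Thm. 5.7] [cite: GreenbergLNM1716, §4 pp. 112–113 and Thm. 1.5 (p. 61)]
[cite: Kato2004Asterisque, Thm. 17.4 (1)(2) (p. 273; shape) and §17.13] -/
theorem splitMultRankZeroTwoConverse_of_wallS3_of_katoRat'
    (h41sp : thm41Analogue_charValue_rankZero_split_baseChange_anyPrime)
    (hmod : nonempty_modularParametrizationData) (h15 : thm15_isTorsion_multiplicative_rat)
    (hW : ∀ (W : WeierstrassCurve ℚ) [W.IsElliptic] [W.IsGloballyMinimal],
      W.HasSplitMultiplicativeReductionAtPrime 2 → thm57_weakExceptionalZero_splitMultiplicative_rat W 2)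
    (hKsp : ∀ (W : WeierstrassCurve ℚ) [W.IsElliptic] [W.IsGloballyMinimal],
      W.HasSplitMultiplicativeReductionAtPrime 2 → KatoMultiplicativeDivisibilityRat W 2)
    (hWsp : ∀ (W : WeierstrassCurve ℚ) [W.IsElliptic] [W.IsGloballyMinimal], ¬ W.HasCM → Mult W 2 →
      W.HasSplitMultiplicativeReductionAtPrime 2 → W.selmerCorank 2 = 0 →
        ∃ (W' : WeierstrassCurve ℚ) (_ : W'.IsElliptic) (_ : W'.IsGloballyMinimal),
          IsIsogenous W W' ∧ Mult W' 2 ∧ MultEisensteinDivisibilityAtTwo W') :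
    ∀ (W : WeierstrassCurve ℚ) [W.IsElliptic] [W.IsGloballyMinimal], ¬ W.HasCM → Mult W 2 →
      W.HasSplitMultiplicativeReductionAtPrime 2 → W.selmerCorank 2 = 0 → W.analyticRank = 0 :=
  splitMultRankZeroTwoConverse_of_lamWallSplit_of_katoRat h41sp hmod hW hKsp
    (lamWallSplit_of_wallS3Split_of_katoRat hmod h15 hKsp hWsp)


/-- **LINE `cycint` v4's stub set ⟹ 19219 THROUGH the two `λ`-form roads (modulo K11 at split-at-`2` curves).** PRINT {A235-twin,
A236, modularity, Thm. 1.5, Kato `hne`/`h12`, `hdesc`, Spieß Thm. 5.7} + K11 at split-at-`2` curves (`hKsp`) + λ-WALL-ns (v4's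
`stub_lamNonsplitFinSel`) + v4's `stub_eisSplitFinSel` ⟹ `MultiplicativeRankZeroTwoConverse`, the split stub being first weakened to
λ-WALL-sp (`lamWallSplit_of_wallS3Split_of_katoRat`) and then consumed by the v5 composition
`multiplicativeRankZeroTwoConverse_of_lamWalls_of_descent_of_katoRatSplit`. Consistency of the v4 → v5 re-shape; nothing asserted.
[cite: Kato2004Asterisque, Thm. 17.4 (1)(2) (p. 273; shape) and §17.13 (pp. 279–280)] [cite: Spiess2014Invent, Thm. 5.7]
[cite: GreenbergLNM1716, §4 pp. 112–113 and Thm. 1.5 (p. 61)] [cite: GreenbergVatsal2000, §2 p. 28 and p. 4] -/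
theorem multiplicativeRankZeroTwoConverse_of_lamWallNonsplit_of_wallS3Split_of_katoRat
    (h41ns : thm41Analogue_charValue_rankZero_numberField_anyPrime_oddLocalDegree)
    (h41sp : thm41Analogue_charValue_rankZero_split_baseChange_anyPrime)
    (hmod : nonempty_modularParametrizationData) (h15 : thm15_isTorsion_multiplicative_rat)
    (hne : Kato2004.nonempty_iwasawaH1Data) (h12 : Kato2004.thm12_4)
    (hdesc : Kato2004.exists_multDivisibilityInputsDescent_nonsplit)
    (hW : ∀ (W : WeierstrassCurve ℚ) [W.IsElliptic] [W.IsGloballyMinimal],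
      W.HasSplitMultiplicativeReductionAtPrime 2 → thm57_weakExceptionalZero_splitMultiplicative_rat W 2)
    (hKsp : ∀ (W : WeierstrassCurve ℚ) [W.IsElliptic] [W.IsGloballyMinimal],
      W.HasSplitMultiplicativeReductionAtPrime 2 → KatoMultiplicativeDivisibilityRat W 2)
    (hWns : ∀ (W : WeierstrassCurve ℚ) [W.IsElliptic] [W.IsGloballyMinimal], ¬ W.HasCM → Mult W 2 →
      ¬ W.HasSplitMultiplicativeReductionAtPrime 2 → W.selmerCorank 2 = 0 →
      ∀ (κ : ZpExtension ℚ 2) (γ : Field.absoluteGaloisGroup ℚ), κ.IsCyclotomic →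
      κ.IsTopGenerator γ → IsCyclotomicVariable 2 γ →
      ∀ ⦃N : ℕ⦄ [NeZero N] (f : CuspForm (Gamma0 N) 2), IsNewformOf W f →
      ∀ (D : W.SelmerDualData κ γ) (g h : IwasawaAlgebra 2) (n : ℕ), D.charIdeal = Ideal.span {g} →
      ∀ L : PowerSeries ℚ_[2], IsMultPAdicLFunctionOf f 2 (-1) L →
        iwasawaToPowerSeries 2 (g * h) = PowerSeries.C ((2 : ℚ_[2]) ^ n) * L →
        g * h ≠ 0 ∧ lam (g * h) ≤ lam g)
    (hWsp : ∀ (W : WeierstrassCurve ℚ) [W.IsElliptic] [W.IsGloballyMinimal], ¬ W.HasCM → Mult W 2 →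
      W.HasSplitMultiplicativeReductionAtPrime 2 → W.selmerCorank 2 = 0 →
        ∃ (W' : WeierstrassCurve ℚ) (_ : W'.IsElliptic) (_ : W'.IsGloballyMinimal),
          IsIsogenous W W' ∧ Mult W' 2 ∧ MultEisensteinDivisibilityAtTwo W') :
    MultiplicativeRankZeroTwoConverse :=
  multiplicativeRankZeroTwoConverse_of_lamWalls_of_descent_of_katoRatSplit h41ns h41sp hmod h15 hne h12 hdesc hW hKsp hWns
    (lamWallSplit_of_wallS3Split_of_katoRat hmod h15 hKsp hWsp)

end MultLambdaWall

end Summit.BirchSwinnertonDyer.BirchSwinnertonDyer.Theorems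

end
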